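import Summits.SmoothPoincare4.SmoothPoincare4.Theorems.SullivanDualTargetOfSympcap

/-!
# SmoothPoincare4 / SullivanDual — crux `Target` (stmt-SmoothPoincare4-7823), line `Sketch`:
# the entry door `target_of_tamingForm`

Two of the four crux ideas for `Target` (`Cruxes/Target/Ideas/kaehler-jacket.md`,
`last-twisted-circle.md`) close the crux through ONE closed form per `(Σ, p)`: a smooth closed
`2`-form on `Σ ∖ p` which is STANDARD on some punctured chart-ball `B_{ε₁}` (`= ι*ω₀` through
the chart at `p`) and tames a smooth almost complex structure `J` everywhere.  This file lands
that door in the tree, VERBATIM the signature `target_of_tamingForm` of the ideator's sketch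
(`Cruxes/Target/SketchIdeator1.lean`), over the landed two-line kill
`SullivanDual.noWitness_of_closed_standard_tames` ((W3) gives `T sf ≤ 0`, (W1) gives `0 < T sf`).

References: D. Sullivan, Invent. Math. 36 (1976), Thm. I.7 [Sullivan1976]; M. Gromov, Invent.
Math. 82 (1985), §0.3.C [Gromov1985].
-/

noncomputable section

-- the registered namespace `Summit.SmoothPoincare4.SmoothPoincare4.Theorems` repeats a component
set_option linter.dupNamespace false

open scoped Manifold ContDiff Topology
open Literature.Geometry.Kaehler Literature.Geometry.Symplectic Literature.Topology.FourManifolds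

namespace Summit.SmoothPoincare4.SmoothPoincare4.Theorems

namespace SullivanDual

/-- **The matrix of `Target` at `(Σ, p)` from one closed taming form standard near `p`.** If a
smooth `J` with `J² = -1` on `Σ ∖ p` is tamed everywhere by a smooth closed `2`-form `sf` that is
standard on the punctured `ε₁`-chart-ball, then `J` has no taming witness at any radius
`0 < ε ≤ ε₁` (`noWitness_of_closed_standard_tames`: standardness passes to smaller balls).
[cite: Sullivan1976, Thm. I.7] -/
theorem targetAt_of_tamingForm {M : Type*} [TopologicalSpace M]
    [ChartedSpace (EuclideanSpace ℝ (Fin 4)) M] [T1Space M] (p : M)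
    (J : ∀ x : punctured p, TangentSpace (𝓡 4) x →L[ℝ] TangentSpace (𝓡 4) x) {ε₁ : ℝ}
    {sf : MForm (𝓡 4) (punctured p) ℝ 2} (hs : IsSmoothForm sf) (hc : IsClosedForm sf)
    (hstd : IsStandardOnBall p ε₁ sf)
    (ht : ∀ (x : punctured p) (v : TangentSpace (𝓡 4) x), v ≠ 0 → 0 < sf x ![v, J x v]) :
    ∀ ε : ℝ, 0 < ε → ε ≤ ε₁ → NoWitness p ε J :=
  fun _ _ hle => noWitness_of_closed_standard_tames p hle J hs hc hstd ht

/-- **`Target` from ONE closed taming form per `(Σ, p)`** (entry door of the crux ideas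
`kaehler-jacket` and `last-twisted-circle`; verbatim the ideator's `target_of_tamingForm`): if
every punctured homotopy 4-sphere `Σ ∖ p` carries a smooth `J` with `J² = -1` and a smooth CLOSED
`2`-form which is standard on some punctured `ε₁`-chart-ball and tames `J` everywhere, then route
SullivanDual's `Target` holds — with that `J` and that `ε₁`: at every radius `ε ≤ ε₁` a taming
witness `T` would have `T sf ≤ 0` by (W3) and `0 < T sf` by (W1). [cite: Sullivan1976, Thm. I.7] -/
theorem target_of_tamingForm
    (h : ∀ (S : Literature.Topology.FourManifolds.HomotopySphere 4) (p : S.carrier),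
      ∃ (J : ∀ x : punctured p, TangentSpace (𝓡 4) x →L[ℝ] TangentSpace (𝓡 4) x),
        (∀ (x : punctured p) (v : TangentSpace (𝓡 4) x), J x (J x v) = -v) ∧
        (∀ x₀ : punctured p, ContMDiffAt (𝓡 4)
          𝓘(ℝ, EuclideanSpace ℝ (Fin 4) →L[ℝ] EuclideanSpace ℝ (Fin 4)) ∞
          (inTangentCoordinates (𝓡 4) (𝓡 4) (id : punctured p → punctured p) id
            (fun x => J x) x₀) x₀) ∧
        ∃ ε₁ : ℝ, 0 < ε₁ ∧ ∃ sf : MForm (𝓡 4) (punctured p) ℝ 2,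
          IsSmoothForm sf ∧ IsClosedForm sf ∧ IsStandardOnBall p ε₁ sf ∧
          ∀ (x : punctured p) (v : TangentSpace (𝓡 4) x), v ≠ 0 → 0 < sf x ![v, J x v]) :
    Summit.SmoothPoincare4.SmoothPoincare4.Theses.SullivanDual.Target := by
  intro S p
  obtain ⟨J, hJ2, hJs, ε₁, hε₁, sf, hs, hc, hstd, ht⟩ := h S p
  exact ⟨J, hJ2, hJs, ε₁, hε₁, fun ε hε hle => targetAt_of_tamingForm p J hs hc hstd ht ε hε hle⟩

end SullivanDual

end Summit.SmoothPoincare4.SmoothPoincare4.Theorems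

end
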